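import Summits.ABC.IUTFork.ForkInputStrip
import Summits.ABC.IUTFork.ForkLocalGlobal
import Summits.ABC.IUTFork.ForkLocalGlobalWitness
import Summits.ABC.IUTFork.Cor312TeamAGapWitnessB
import HarnessLib

/-!
# The fork at [IUTchIII] Corollary 3.12 — the GLOBAL gap: countermodel transfer and algorithm-independence (skeleton XXVb)

Record-only file (D-0012) of the abc-iut cell (skeleton seat abc-iut-skel, gen 4); TAKES NO SIDE. Contacts of XXV
`ForkInputStrip` (the global gap `InputStrip.StripAlgorithm.GapGlobal` — soundness of the multiradial algorithm at the
link-identified input prime-strip, [IUTchIII] Cor. 3.12 Step (xi-f), kurims `paper:url-4b091feeb646` p. 184 l. 19–29) with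
the cell's adjudication objects (plan/ADJUDICATION-SPEC §2):

* (G3) **The STRONG interface-level countermodel TRANSFERS to the global gap.** Team A's isolation theorem
  (abc-iut-c312-9, `Cor312Vol.GapWitness.thm311_bridgeHyps_not_imp_statement`: an instantiation with the typed Theorem 3.11
  (i) ∧ (ii) ∧ (iii), every bridge hypothesis and `|log(q)| > 0` in which the typed Corollary FAILS) gives, verbatim, an
  instantiation in which EVERY strip algorithm over the setting violates `GapGlobal` (`not_gapGlobal_gapSetting`,
  `thm311_bridgeHyps_not_imp_gapGlobal`; file name and decl per abc-iut-plan's ruling INBOX 23:46:46Z):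
  by XXV's `statement_of_gapGlobal`, wherever the Statement fails under the bridge hypotheses the global gap fails for every
  filling of the slots (`not_gapGlobal_of_not_statement`). So the global GapA is NOT derivable from the typed Thm. 3.11 +
  bridge hypotheses — the (G3) evidence is STRONG in the spec's grading, at the global quantifier level too.
* (G1′) **Per-packet soundness is a per-packet reading.** If the pilot-object log-volume of the input strip is itself read
  per packet (`holVolLocal`, summing to `holVol` — which for the q-pilot strip Step (xii) p. 185–186 says is NOT available:
  local Frobenioid objects are determined only up to `p_v^N`) then per-packet soundness at the q-strip IS Reading 0
  (`soundPerPacket_qIn_iff_pointwise`), hence subject to XXIV's local horn (`perPlace_bound_of_pointwise`): the quantifier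
  choice is exactly the choice between the refutable per-packet family and the global Corollary.

NOTE ON `Sound₁` (self-audit of XXV, INBOX 23:56:19Z): `StripAlgorithm.Sound₁ := ∀ s, Realized₁ s → SoundAt s` is faithful to
the print's (SHE) only when the slot `Realized₁` is instantiated by the input prime-strips of the link's horizontal arrows (the
q-pilot strips `^{1,m}𝓕^⊩▶×μ_△`; then `Sound₁ ⟺ GapGlobal`). With a permissive `Realized₁` ("any strip realized in the 1-column")
it fails for reasons unrelated to [IUTchIII]: an arithmetic line bundle of small degree whose `𝓕^⊩▶×μ`-prime-strip is abstractly
isomorphic to the Θ-pilot's (abstract strips do not see the valuation of the splitting generator) has pilot volume above the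
hull volume — XXV's `not_sound₁_twoStrip` is that shape. The GapA of record is therefore the q-instance `GapGlobal`.
[claim: Mochizuki2012, status: disputed] Deliberately NOT here: the (R)-lane contact `gapA_of_identified` (Team R,
abc-iut-c312-15, against `GapGlobal`); any judgement on (xi-f).
-/

noncomputable section

namespace Summit.ABC

namespace IUTFork

namespace InputStrip

open Thm311 Cor312 Cor312Vol Literature.IUT.LogThetaLattice

variable {T : ThetaIndex} {S : Situation T} {P : Cor312.Setting S}

/-! ## 0. Honesty, packaged: at the frozen level the global gap is the Corollary and does not depend on the algorithm -/

/-- **`GapGlobal` ⟺ the printed Statement** under "`−|log(Θ)| ∈ ℝ`" (`ThetaFinite`) — the packaged form of XXV's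
`soundAt_qIn_iff` (RQ7 audits w5-d034 / w5-d048 of p412442): absent an M-level predicate "this `StripAlgorithm` IS the
algorithm of Thm. 3.11 on the real `𝓕^⊩▶×μ`-prime-strips", every XXV-level wording of the gap is the Corollary's inequality.
[claim: Mochizuki2012, status: disputed] -/
theorem gapGlobal_iff_statement (A : StripAlgorithm P) (h : P.ThetaFinite) : A.GapGlobal ↔ P.Statement := by
  rw [A.soundAt_qIn_iff]
  unfold Setting.Statement Setting.negLogTheta
  rw [if_pos h]
  exact ⟨fun hle => ⟨WithTop.coe_ne_top, hle⟩, fun hs => hs.2⟩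

/-- **`GapGlobal` does not depend on the strip algorithm** (all fillings of the slots give the same proposition).
[folklore] -/
theorem gapGlobal_indep (A A' : StripAlgorithm P) : A.GapGlobal ↔ A'.GapGlobal := by
  rw [A.soundAt_qIn_iff, A'.soundAt_qIn_iff]

/-! ## 1. (G3): the interface-level countermodel transfers to the global gap -/

/-- Wherever the Statement fails under the bridge hypotheses, the global gap fails for EVERY strip algorithm over
the setting (contrapositive of XXV's `statement_of_gapGlobal`). [folklore] -/
theorem not_gapGlobal_of_not_statement (H : BridgeHyps P) (h : ¬ P.Statement) (A : StripAlgorithm P) :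
    ¬ A.GapGlobal :=
  fun hg => h (A.statement_of_gapGlobal H hg)

/-- Over Team A's gap witness (`GapWitness.gapSetting`: typed Thm. 3.11 holds, all bridge hypotheses hold,
`|log(q)| > 0`, the Statement fails) every strip algorithm violates the global gap. [folklore] -/
theorem not_gapGlobal_gapSetting (A : StripAlgorithm GapWitness.gapSetting) : ¬ A.GapGlobal :=
  not_gapGlobal_of_not_statement GapWitness.gapSetting_bridgeHyps GapWitness.gapSetting_not_statement A

/-- **(G3) at the global quantifier level.** There is an instantiation in which the typed Theorem 3.11 (i) ∧ (ii) ∧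
(iii) holds in full, every bridge hypothesis holds, `|log(q)| > 0`, the slots of a strip algorithm are fillable —
and the GLOBAL gap `GapGlobal` fails for EVERY strip algorithm over the setting. Hence the global GapA of record is
not derivable from the typed Thm. 3.11 + the bridge hypotheses (Team A's `thm311_bridgeHyps_not_imp_statement`,
transferred through `statement_of_gapGlobal`). [claim: Mochizuki2012, status: disputed] -/
theorem thm311_bridgeHyps_not_imp_gapGlobal :
    ∃ (T : ThetaIndex) (F : FullSituation T) (P : Setting F.toLatticeSituation.toSituation) (_ : BridgeHyps P),
      F.Statement ∧ P.AbsLogQPos ∧ Nonempty (StripAlgorithm P) ∧ ∀ A : StripAlgorithm P, ¬ A.GapGlobal :=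
  ⟨Cor312.Checks.toyIndex, GapWitness.gapFull, GapWitness.gapSetting, GapWitness.gapSetting_bridgeHyps,
    GapWitness.gapFull_statement, GapWitness.gapSetting_absLogQPos, ⟨StripAlgorithm.canonical _⟩,
    not_gapGlobal_gapSetting⟩

/-! ## 2. (G1′): per-packet soundness at the q-strip is Reading 0 -/

/-- A PER-PACKET reading of the pilot-object log-volume of the inputs: local contributions `holVolLocal s j v_ℚ` whose
procession-normalized sum is `holVol s`, with the q-strip's local contributions the `qLocal` of the setting. For the
q-pilot strip this is exactly what Step (xii) (p. 185 l. 59 – p. 186 l. 3) says is NOT available — recorded here only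
to show where the per-packet readings come from. DATA, asserts nothing. [claim: Mochizuki2012, status: disputed] -/
structure LocalVolumes (A : StripAlgorithm P) where
  /-- per-packet pilot-object log-volume of an input -/
  holVolLocal : A.In → Fin T.lstar → T.VQ → ℝ
  /-- at the q-strip it is the local `q`-pilot log-volume of the setting -/
  holVolLocal_qIn : ∀ (i : Fin T.lstar) (vQ : T.VQ), holVolLocal A.qIn i vQ = P.qLocal (Setting.labelSucc i) vQ

/-- PER-PACKET SOUNDNESS at an input: in every packet the local pilot volume is at most the local hull-volume of the
output possibilities. [claim: Mochizuki2012, status: disputed] -/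
@[claim "Mochizuki2012" "disputed"] def StripAlgorithm.SoundPerPacket (A : StripAlgorithm P) (V : LocalVolumes A)
    (s : A.In) : Prop :=
  ∀ (i : Fin T.lstar) (vQ : T.VQ),
    ((V.holVolLocal s i vQ : ℝ) : WithTop ℝ) ≤ localVolOf P (A.out s) (Setting.labelSucc i) vQ

/-- **Per-packet soundness at the q-strip IS Reading 0** (pointwise `qLocal ≤ thetaLocal`), under "`−|log(Θ)| ∈ ℝ`"
(`ThetaFinite`, from the bridge hypotheses): so it inherits XXIV's local horn — composed with the per-packet upper
bound of [IUTchIV] Thm. 1.10 Step (v) it is a per-place height bound (`Cor312Vol.perPlace_bound_of_pointwise`).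
[claim: Mochizuki2012, status: disputed] -/
theorem soundPerPacket_qIn_iff_pointwise (H : BridgeHyps P) (A : StripAlgorithm P) (V : LocalVolumes A) :
    A.SoundPerPacket V A.qIn ↔
      ∀ (i : Fin T.lstar) (vQ : T.VQ),
        P.qLocal (Setting.labelSucc i) vQ ≤ (P.thetaLocal (Setting.labelSucc i) vQ).untopD 0 := by
  unfold StripAlgorithm.SoundPerPacket
  refine forall_congr' fun i => forall_congr' fun vQ => ?_
  rw [V.holVolLocal_qIn, A.out_qIn, localVolOf_possibleImages, thetaLocal_untopD H]
  have hdef := hullDefined_of_finite H i vQ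
  unfold Setting.thetaLocal
  rw [if_pos hdef, WithTop.coe_le_coe]

/-- Hence per-packet soundness at the q-strip, composed with a per-packet upper bound of the Step (v) shape at one
packet, is a per-place bound there (XXIV `perPlace_bound_of_pointwise`). [claim: Mochizuki2012, status: disputed] -/
theorem perPlace_bound_of_soundPerPacket (H : BridgeHyps P) (A : StripAlgorithm P) (V : LocalVolumes A)
    (h : A.SoundPerPacket V A.qIn) {i : Fin T.lstar} {vQ : T.VQ} {w κ : ℝ}
    (hUB : (P.thetaLocal (Setting.labelSucc i) vQ).untopD 0 ≤ w * P.qLocal (Setting.labelSucc i) vQ + κ) :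
    (w - 1) * (-P.qLocal (Setting.labelSucc i) vQ) ≤ κ :=
  perPlace_bound_of_pointwise ((soundPerPacket_qIn_iff_pointwise H A V).mp h i vQ) hUB

/-- And in XXIVb's witness `LocalGlobal.lgSetting` (Statement, R1 and all bridge hypotheses hold) per-packet soundness
at the q-strip FAILS for every strip algorithm and every per-packet volume datum, while the global gap HOLDS.
[folklore] -/
theorem lg_gapGlobal_not_soundPerPacket (A : StripAlgorithm LocalGlobal.lgSetting) (V : LocalVolumes A) :
    A.GapGlobal ∧ ¬ A.SoundPerPacket V A.qIn :=
  ⟨A.gapGlobal_of_statement LocalGlobal.lg_statement,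
    fun h => LocalGlobal.lg_not_pointwise ((soundPerPacket_qIn_iff_pointwise LocalGlobal.lg_bridgeHyps A V).mp h)⟩

end InputStrip

end IUTFork

end Summit.ABC

end
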